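import Mathlib

/-!
# Route NikulinTwinTransport · crux `TwinTwistorTransport` (stmt-HodgeConjecture-14393) —
# stub `stub_commutant` of line `Sketch` (idea `ordinary-prime-anchors`, step (A1))

Pure linear algebra (Mathlib only): if an endomorphism `F` of a finite-dimensional vector space
`T` over a field `L` has IRREDUCIBLE characteristic polynomial, then every endomorphism `ψ`
commuting with `F` is a polynomial in `F`; i.e. the commutant of `F` is `L[F] ≅ L[X]/(χ_F)`.

Proof. `T ≠ 0` (an irreducible polynomial has positive degree `= finrank L T`); pick `v ≠ 0`.
The annihilator ideal `{p | p(F) v = 0}` of `v` in the PID `L[X]` contains `χ_F` (Cayley–Hamilton)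
and is proper, while `(χ_F)` is maximal, so it equals `(χ_F)`. Hence the orbit map
`p ↦ p(F) v` is injective on polynomials of degree `< finrank L T`, so by a dimension count it is
onto: `v` is a cyclic vector. Writing `ψ v = q(F) v`, commutation gives `ψ = q(F)` on every
`p(F) v`, i.e. everywhere.

This is step (A1) of the card `ordinary-prime-anchors` (the commutant of Frobenius on the
transcendental lattice of an ordinary K3 surface is the CM field `L[F]`); it supports the
load-bearing stub `stub_twinTransport` of the skeleton `Cruxes/TwinTwistorTransport/Lines/Sketch.lean`.
-/

open Polynomial

namespace Summit.HodgeConjecture.HodgeConjecture.Theorems.NikulinTwinTransport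

/-- If `F` has irreducible characteristic polynomial and `v ≠ 0`, then every polynomial `p` with
`p(F) v = 0` is a multiple of the characteristic polynomial: the annihilator ideal of `v` in
`L[X]` contains `χ_F` (Cayley–Hamilton), is proper, and `(χ_F)` is maximal. -/
theorem charpoly_dvd_of_aeval_apply_eq_zero {L : Type*} [Field L] {T : Type*} [AddCommGroup T]
    [Module L T] [FiniteDimensional L T] {F : Module.End L T} (hirr : Irreducible F.charpoly)
    {v : T} (hv : v ≠ 0) {p : L[X]} (hp : aeval F p v = 0) : F.charpoly ∣ p := by
  set x : Module.AEval' F := Module.AEval'.of F v with hx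
  have key : ∀ q : L[X], q ∈ Ideal.torsionOf L[X] (Module.AEval' F) x ↔ aeval F q v = 0 := by
    intro q
    rw [Ideal.mem_torsionOf_iff, hx, ← Module.AEval.of_aeval_smul, map_eq_zero_iff _
      (Module.AEval'.of F).injective]
    rfl
  have hle : Ideal.span {F.charpoly} ≤ Ideal.torsionOf L[X] (Module.AEval' F) x := by
    rw [Ideal.span_singleton_le_iff_mem, key, LinearMap.aeval_self_charpoly, LinearMap.zero_apply]
  have hne : Ideal.torsionOf L[X] (Module.AEval' F) x ≠ ⊤ := by
    rw [Ne, Ideal.torsionOf_eq_top_iff, hx, map_eq_zero_iff _ (Module.AEval'.of F).injective]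
    exact hv
  have hmax : (Ideal.span {F.charpoly}).IsMaximal :=
    PrincipalIdealRing.isMaximal_of_irreducible hirr
  have heq : Ideal.span {F.charpoly} = Ideal.torsionOf L[X] (Module.AEval' F) x :=
    hmax.eq_of_le hne hle
  rw [← Ideal.mem_span_singleton, heq, key]
  exact hp

/-- If `F` has irreducible characteristic polynomial, every nonzero vector `v` is CYCLIC for `F`:
each `w` is `p(F) v` for some polynomial `p` (the orbit map is injective on polynomials of degree
`< finrank L T = deg χ_F`, hence onto by a dimension count). -/
theorem exists_eq_aeval_apply_of_irreducible_charpoly {L : Type*} [Field L] {T : Type*}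
    [AddCommGroup T] [Module L T] [FiniteDimensional L T] {F : Module.End L T}
    (hirr : Irreducible F.charpoly) {v : T} (hv : v ≠ 0) (w : T) :
    ∃ p : L[X], w = aeval F p v := by
  set n : ℕ := Module.finrank L T with hn_def
  have hn : F.charpoly.natDegree = n := F.charpoly_natDegree
  let ρ : L[X] →ₗ[L] T :=
    { toFun := fun p => aeval F p v
      map_add' := fun p q => by simp only [map_add, LinearMap.add_apply]
      map_smul' := fun c p => by simp only [map_smul, LinearMap.smul_apply, RingHom.id_apply] }
  let ρ' : Polynomial.degreeLT L n →ₗ[L] T := ρ ∘ₗ (Polynomial.degreeLT L n).subtype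
  have hinj : Function.Injective ρ' := by
    rw [← LinearMap.ker_eq_bot, LinearMap.ker_eq_bot']
    rintro ⟨p, hp⟩ hp0
    have hdvd : F.charpoly ∣ p := charpoly_dvd_of_aeval_apply_eq_zero hirr hv hp0
    have hdeg : p.degree < F.charpoly.degree := by
      rw [Polynomial.degree_eq_natDegree F.charpoly_monic.ne_zero, hn]
      exact Polynomial.mem_degreeLT.mp hp
    exact Subtype.ext (Polynomial.eq_zero_of_dvd_of_degree_lt hdvd hdeg)
  have hrange : LinearMap.range ρ' = ⊤ := by
    apply Submodule.eq_top_of_finrank_eq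
    rw [LinearMap.finrank_range_of_inj hinj, (Polynomial.degreeLTEquiv L n).finrank_eq,
      Module.finrank_fin_fun]
  have hw : w ∈ LinearMap.range ρ' := hrange ▸ Submodule.mem_top
  obtain ⟨p, hp⟩ := hw
  exact ⟨p.1, hp.symm⟩

/-- Commutant of an endomorphism with irreducible characteristic polynomial is `L[F]`: if the
characteristic polynomial of `F : Module.End L T` (`T` finite-dimensional over the field `L`) is
irreducible, then every `ψ` commuting with `F` is `p(F)` for some `p : L[X]` (the `L[X]`-module
`T` is cyclic, `≅ L[X]/(χ_F)`, a field). Step (A1) of idea ordinary-prime-anchors for crux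
TwinTwistorTransport (the commutant of Frobenius on the transcendental lattice of an ordinary K3
surface is the CM field `K_𝔭 = L[F]`); [folklore]. -/
theorem stub_commutant : ∀ (L : Type) [Field L] (T : Type) [AddCommGroup T] [Module L T] [FiniteDimensional L T] (F : Module.End L T), Irreducible F.charpoly → ∀ ψ : Module.End L T, ψ ∘ₗ F = F ∘ₗ ψ → ∃ p : L[X], ψ = aeval F p := by
  intro L _ T _ _ _ F hirr ψ hψ
  have hpos : 0 < Module.finrank L T := by
    rw [← F.charpoly_natDegree]
    exact hirr.natDegree_pos
  obtain ⟨v, hv⟩ := Module.finrank_pos_iff_exists_ne_zero.mp hpos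
  have hc : Commute F ψ := hψ.symm
  have hcomm : ∀ (p : L[X]) (w : T), ψ (aeval F p w) = aeval F p (ψ w) := by
    intro p w
    have h : Commute (aeval F p) ψ := by
      rw [Polynomial.aeval_eq_smeval]
      exact Polynomial.smeval_commute_left L p hc
    exact (LinearMap.congr_fun h.eq w).symm
  obtain ⟨q, hq⟩ := exists_eq_aeval_apply_of_irreducible_charpoly hirr hv (ψ v)
  refine ⟨q, LinearMap.ext fun w => ?_⟩
  obtain ⟨p, rfl⟩ := exists_eq_aeval_apply_of_irreducible_charpoly hirr hv w
  calc ψ (aeval F p v) = aeval F p (ψ v) := hcomm p v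
    _ = aeval F p (aeval F q v) := by rw [hq]
    _ = aeval F (p * q) v := by rw [map_mul, Module.End.mul_apply]
    _ = aeval F (q * p) v := by rw [mul_comm]
    _ = aeval F q (aeval F p v) := by rw [map_mul, Module.End.mul_apply]

end Summit.HodgeConjecture.HodgeConjecture.Theorems.NikulinTwinTransport
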